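import Literature.AlgebraicGeometry.Surfaces.K3MarkingProofs
import HarnessLib

/-!
# Markings of K3 surfaces (Huybrechts, Ch. 1 Prop. 3.5): decomposition of the named fact into the
# inputs of its printed proof

Family `hodge`, layer `Literature/AlgebraicGeometry/Surfaces`. FACT DECOMPOSITION (librarian,
2026-08-16) of the capped named fact `Literature.AlgebraicGeometry.Surfaces.Huybrechts_K3_marking_exists`
(`K3Marking.lean`: every K3 surface `S/ℂ` is marked, `H²(S(ℂ); ℤ) ≅ Λ_{K3} = E₈(−1)^{⊕2} ⊕ U^{⊕3}`
compatibly with the cup product, with period point in the period domain and an ample lattice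
vector; D. Huybrechts, *Lectures on K3 Surfaces*, CUP 2016, Ch. 1 Prop. 3.5, Ch. 3 Def. 2.3,
Ch. 6 Prop. 1.2, Ch. 1 §3).

The proof file `K3MarkingProofs.lean` (its seat's Parts I–VI, all PROVED) reduces the fact to the
inputs of Huybrechts' printed proof of Prop. 3.5 (p. 24: "`H²(X, ℤ)` is … free of rank 22 … the
intersection pairing is even … of index −16 by the Thom–Hirzebruch index theorem … by Cor. 14.1.3 it
is enough to prove that `H²(X, ℤ)` is even of signature `(3,19)`") and of the period relations:
`Huybrechts_K3_marking_exists.of_facts` takes four NAMED FACTS of the tree — Voisin I Cor. 7.6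
(`HodgeTheory.Voisin2002_closedForm_top_zero_not_exact`), the Hodge types of `H²` of a K3 surface
(`Huybrechts_K3_hodgeTypes_H2`), independence of the Hodge model
(`HodgeTheory.hodgePQ_independent_of_hodgeModel`) and de Rham's theorem in multiplicative form
(`Literature.NumberTheory.Transcendental.exists_deRhamIsoFamily`) — and ONE inline hypothesis `h`
bundling, for every K3 surface and one `ℤ`-orientation `μ` of `S(ℂ)`, the numerical invariants
`b₂ = 22`, evenness, index `−16`, the Hodge–Riemann positivity on `H^{2,0}` and an integral
`(1,1)`-class of positive square; Milnor's classification of indefinite even unimodular lattices,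
unimodularity (Poincaré duality), universal coefficients and the type bookkeeping are the tree's.
This file names the content of `h` as THREE facts (`def … : Prop`, D-0014), each a printed
statement, and proves the assembly:

* `K3_finrank_complexBetti_two` — **`b₂(X) = 22`** (Huybrechts Ch. 1 §3.3, p. 24: "`e(X) = c₂(X)
  = 24` … Since `b₁(X) = b₃(X) = 0` and `b₀(X) = b₄(X) = 1`, this shows `b₂(X) = 22`"; Noether's
  formula Ch. 1 §2.4 (2.6) gives `c₂ = 24`, and `b₁ = 0` from `H¹(X, 𝒪_X) = 0`). Orientation-free.
* `K3_even_intersectionForm` — **the intersection form on `H²(X, ℤ)` is even** (ibid., proof of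
  Prop. 3.5: Wu's formula `(α.α) ≡ (w₂(X).α) (2)` and `w₂(X) ≡ c₁(X) = 0 (2)`; Milnor–Stasheff §11
  Thm. 11.14, §14 Problem 14-B). Stated for EVERY `ℤ`-orientation (evenness is insensitive to the
  sign of `[S(ℂ)]`).
* `K3_exists_orientation_signature_hodgeRiemann_ample` — **the positivity package of the complex
  orientation**: for some `ℤ`-orientation `μ` of `S(ℂ)` (the complex one), (i) the intersection
  form has index `τ = −16`, i.e. signature `(3, 19)` (ibid.: Thom–Hirzebruch,
  `τ = (c₁² − 2c₂)/3 = −16`; Milnor–Stasheff Thm. 19.4); (ii) the Hodge–Riemann relation on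
  `H^{2,0}`: `(σ̄.σ) > 0` for every non-zero `(2,0)`-class `σ` (Huybrechts Ch. 6 Prop. 1.2 (ii)
  "(σ.σ̄) > 0", Ch. 3 §1.1; Voisin I §6.3.2), written `σ̄ ∪ σ = c · (g ⊗ 1)`, `re c > 0`, against the
  Kronecker dual `g` of `[S(ℂ)]_μ`; (iii) an integral `(1,1)`-class of positive square (the first
  Chern class of an ample line bundle on the projective `S`: Huybrechts Ch. 1 §2.2–§3 and
  Prop. 3.2 (GAGA); `(L.L) = deg > 0`). The three clauses are distinct theorems but must be stated
  for the SAME orientation, and the tree does not single out the complex orientation of `X(ℂ)`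
  among the two `ℤ`-orientations of the connected closed `4`-manifold `S(ℂ)` (module docstring of
  `Motives/ComplexPointsOrientation.lean`: "which of the two orientations … is 'the complex one' is
  not tracked"); clauses (ii)/(iii) fix that sign, clause (i) is then Hirzebruch's theorem for it.
  A later decomposition may introduce `complexOrientation` (via `positiveAtlasOrientation` of the
  holomorphic atlas of a Hodge model) and split this bundle into its three theorems.

Assembly (proved): `Huybrechts_K3_marking_exists_holds_of` — the three facts above together with
the four pre-existing named facts, fed to `Huybrechts_K3_marking_exists.of_facts`. Nothing is
restated: the parent is an existence statement about markings `H²(S(ℂ); ℂ) ≃ Λ_ℂ`, the children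
are numerical/positivity statements about the intersection form and the Hodge classes.

## References

* [Huybrechts2016K3] D. Huybrechts, *Lectures on K3 Surfaces*, CUP 2016: Ch. 1 §2.4 (2.6), §3.3
  and Prop. 3.5 with its proof (p. 24), Prop. 3.2; Ch. 3 §1.1, Def. 2.3; Ch. 6 §1.1, Prop. 1.2;
  Ch. 14 Cor. 1.3.
* [MilnorStasheff1974] J. Milnor, J. Stasheff, *Characteristic Classes*, Princeton 1974: §11
  Thm. 11.14 (Wu's formula), §14 Problem 14-B (`w₂ ≡ c₁`), §19 Thm. 19.4 (signature theorem).
* [VoisinHodgeI2002] C. Voisin, *Hodge Theory and Complex Algebraic Geometry I*, CUP 2002, §6.3.2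
  (Hodge–Riemann bilinear relations), Thm. 6.32.
-/

noncomputable section

open scoped Manifold ContDiff
open CategoryTheory
open Literature.AlgebraicTopology.SingularHomology
open Literature.Topology.FourManifolds
open Literature.NumberTheory.Transcendental (exists_deRhamIsoFamily)

namespace Literature.AlgebraicGeometry.Surfaces

/-! ### The three inputs of Huybrechts' proof of Prop. 3.5 (named facts) -/

/-- **`b₂ = 22` for a K3 surface** (Huybrechts, *Lectures on K3 Surfaces*, Ch. 1 §3.3, p. 24:
"`e(X) = c₂(X) = 24` … Since `b₁(X) = b₃(X) = 0` and `b₀(X) = b₄(X) = 1`, this shows `b₂(X) = 22`";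
`c₂(X) = 24` is Noether's formula `χ(X, 𝒪_X) = (c₁² + c₂)/12 = 2`, Ch. 1 §2.4 (2.6), and `b₁ = 0`
comes from `H¹(X, 𝒪_X) = 0`). Rendering: for every K3 surface `S/ℂ` (`IsK3Surface S`),
`dim_ℂ H²(S(ℂ); ℂ) = 22` (`HodgeTheory.complexBetti S 2` = singular cohomology of the complex
points with `ℂ`-coefficients). Named fact (D-0014), the first conjunct of the hypothesis `h` of
`Huybrechts_K3_marking_exists.of_facts`. [cite: Huybrechts2016K3, Ch. 1 §3.3 p. 24 (b₂(X) = 22) with §2.4 (2.6)] -/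
def K3_finrank_complexBetti_two : Prop :=
  ∀ (S : Motives.SchemeOver ℂ), IsK3Surface S →
    Module.finrank ℂ (HodgeTheory.complexBetti S (2 * 1)) = 22

/-- **The intersection form of a K3 surface is even** (Huybrechts, Ch. 1, proof of Prop. 3.5,
p. 24: "the intersection pairing is even" — by Wu's formula `(α.α) ≡ (w₂(X).α) mod 2`,
Milnor–Stasheff Thm. 11.14, and `w₂(X) ≡ c₁(X) = 0 mod 2`, Problem 14-B, the canonical bundle of a
K3 surface being trivial). Rendering: for every K3 surface `S/ℂ`, EVERY `ℤ`-orientation `μ` of the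
closed `4`-manifold `S(ℂ)` and every `a ∈ H²(S(ℂ); ℤ)`, the integer `⟨a ∪ a, [S(ℂ)]_μ⟩` is even
(evenness does not depend on the sign of the fundamental class, so no orientation needs to be
singled out). Named fact (D-0014), the second conjunct of the hypothesis `h` of
`Huybrechts_K3_marking_exists.of_facts`. [cite: Huybrechts2016K3, Ch. 1 Prop. 3.5, proof (p. 24: the intersection pairing is even)]
[cite: MilnorStasheff1974, §11 Thm. 11.14 (Wu's formula) and §14 Problem 14-B] -/
def K3_even_intersectionForm : Prop :=
  ∀ (S : Motives.SchemeOver ℂ), IsK3Surface S →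
    ∀ (μ : HomologicalOrientation ℤ (Motives.ComplexPoints S) (2 * 2))
      (a : singularCohomology ℤ ℤ (Motives.ComplexPoints S) (2 * 1)),
      Even (kroneckerPairing ℤ ℤ (Motives.ComplexPoints S) (2 * 2)
        (cupProduct (rfl : 2 * 1 + 2 * 1 = 2 * 2) a a) μ.fundamentalClass)

/-- **Signature `(3,19)`, Hodge–Riemann positivity on `H^{2,0}`, and an ample class — for the
complex orientation of a K3 surface** (three printed statements sharing one orientation; see the
module docstring for why they are bundled). For every K3 surface `S/ℂ` there is a `ℤ`-orientation
`μ` of `S(ℂ)` (the complex orientation, Milnor–Stasheff §13 p. 151) such that: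
(i) **index `−16`**: the intersection form `intersectionForm μ` on `H²(S(ℂ); ℤ)/tors` has
signature (`b⁺ − b⁻`) equal to `−16`, i.e. `(b⁺, b⁻) = (3, 19)` given `b₂ = 22` (Huybrechts Ch. 1,
proof of Prop. 3.5, p. 24: "of index `τ(X) = (c₁² − 2c₂)/3 = −16` by the Thom–Hirzebruch index
theorem"; Milnor–Stasheff Thm. 19.4);
(ii) **Hodge–Riemann on `H^{2,0}`**: for every non-zero `(2,0)`-class `σ ∈ H²(S(ℂ); ℂ)` and every
`g ∈ H⁴(S(ℂ); ℤ)` with `⟨g, [S(ℂ)]_μ⟩ = 1`, `σ̄ ∪ σ = c · (g ⊗ 1)` with `re c > 0` (Huybrechts Ch. 6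
Prop. 1.2 (ii): "(σ.σ̄) > 0"; Ch. 3 §1.1; Voisin I §6.3.2, `∫_X σ ∧ σ̄ > 0` for a holomorphic
`2`-form `σ ≠ 0` on a surface);
(iii) **an ample class**: some `u ∈ H²(S(ℂ); ℤ)` whose complexification is of Hodge type `(1,1)`
has `⟨u ∪ u, [S(ℂ)]_μ⟩ > 0` (the first Chern class of an ample line bundle on the projective surface
`S`, Huybrechts Ch. 1 §2.2 and §3 with Prop. 3.2: `c₁(L) ∈ H^{1,1} ∩ H²(X, ℤ)`, `(L.L) > 0`).
Named fact (D-0014): conjuncts three to five of the hypothesis `h` of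
`Huybrechts_K3_marking_exists.of_facts`, verbatim. [cite: Huybrechts2016K3, Ch. 1 Prop. 3.5, proof (p. 24: index −16); Ch. 6 Prop. 1.2 (ii); Ch. 1 §2.2, §3 and Prop. 3.2]
[cite: MilnorStasheff1974, §19 Thm. 19.4 and §13 p. 151] [cite: VoisinHodgeI2002, §6.3.2] -/
def K3_exists_orientation_signature_hodgeRiemann_ample : Prop :=
  ∀ (S : Motives.SchemeOver ℂ), IsK3Surface S →
    ∃ μ : HomologicalOrientation ℤ (Motives.ComplexPoints S) (2 * 2),
      (intersectionForm (rfl : 2 * 1 + 2 * 1 = 2 * 2) μ).signature = -16 ∧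
      (∀ σ : HodgeTheory.complexBetti S (2 * 1), HodgeTheory.IsOfHodgeType 2 S (2 * 1) 2 0 σ →
        σ ≠ 0 → ∀ g : singularCohomology ℤ ℤ (Motives.ComplexPoints S) (2 * 2),
          kroneckerPairing ℤ ℤ (Motives.ComplexPoints S) (2 * 2) g μ.fundamentalClass = 1 →
            ∃ c : ℂ, 0 < c.re ∧
              cupProduct (rfl : 2 * 1 + 2 * 1 = 2 * 2)
                (HodgeTheory.conjClass (Motives.ComplexPoints S) (2 * 1) σ) σ =
                  c • singularCohomology.ringChange (algebraMap ℤ ℂ) (Motives.ComplexPoints S) (2 * 2) g) ∧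
      (∃ u : singularCohomology ℤ ℤ (Motives.ComplexPoints S) (2 * 1),
        HodgeTheory.IsOfHodgeType 2 S (2 * 1) 1 1
            (singularCohomology.ringChange (algebraMap ℤ ℂ) (Motives.ComplexPoints S) (2 * 1) u) ∧
          0 < kroneckerPairing ℤ ℤ (Motives.ComplexPoints S) (2 * 2)
            (cupProduct (rfl : 2 * 1 + 2 * 1 = 2 * 2) u u) μ.fundamentalClass)

/-! ### Assembly -/

/-- **`Huybrechts_K3_marking_exists` from the three facts above and the four pre-existing named
facts of its in-tree reduction** (`Huybrechts_K3_marking_exists.of_facts`, `K3MarkingProofs.lean`: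
Milnor's theorem for even indefinite unimodular lattices of signature `(3,19)`, unimodularity by
Poincaré duality, universal coefficients, `σ ≠ 0` of type `(2,0)` from Voisin I Cor. 7.6,
`(σ)² = 0` and `Λ^{1,1} ⊥ σ` by type, all proved there). The discharge
`Huybrechts_K3_marking_exists_holds` is this theorem applied to the seven `_holds`.
[cite: Huybrechts2016K3, Ch. 1 Prop. 3.5 and its proof (p. 24); Ch. 14 Cor. 1.3 (i); Ch. 6 Prop. 1.2; Ch. 1 §3] -/
theorem Huybrechts_K3_marking_exists_holds_of (h22 : K3_finrank_complexBetti_two)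
    (heven : K3_even_intersectionForm) (hpos : K3_exists_orientation_signature_hodgeRiemann_ample)
    (hV : ∀ (E : Type) [NormedAddCommGroup E] [NormedSpace ℂ E] [FiniteDimensional ℂ E]
      (M : Type) [TopologicalSpace M] [ChartedSpace E M],
      HodgeTheory.Voisin2002_closedForm_top_zero_not_exact E M)
    (hT : Huybrechts_K3_hodgeTypes_H2) (hI : HodgeTheory.hodgePQ_independent_of_hodgeModel)
    (hdR : ∀ (E : Type) [NormedAddCommGroup E] [NormedSpace ℂ E] [FiniteDimensional ℂ E],
      exists_deRhamIsoFamily 𝓘(ℝ, E)) :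
    Huybrechts_K3_marking_exists :=
  Huybrechts_K3_marking_exists.of_facts hV hT hI hdR fun S hS => by
    obtain ⟨μ, hsig, hHR, hamp⟩ := hpos S hS
    exact ⟨μ, h22 S hS, heven S hS μ, hsig, hHR, hamp⟩

end Literature.AlgebraicGeometry.Surfaces

end
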